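import Summits.KontsevichZagierPeriods.KontsevichZagierPeriods.Theses.FermatIsogeny
import Summits.KontsevichZagierPeriods.KontsevichZagierPeriods.Theses.TerasomaMultiplication
import Summits.KontsevichZagierPeriods.KontsevichZagierPeriods.Theorems.FermatIsogenyFermatSectorCompleteBridges

/-!
# `FermatSectorComplete` (stmt-KontsevichZagierPeriods-14252) — line `birth`, skeleton v5 (lead c11; re-registered unchanged by leads c12, 2026-08-17T08:16Z, and c13, 2026-08-17T09:18Z)

Crux 5 of route FermatIsogeny, RELATIVE COMPLETENESS OF THE KZ CALCULUS MODULO THE β-SECTOR: for all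
representations `r r'` of KZ's literal shape with equal value,
`[r] − [r'] ∈ relations ⊔ closure (S_lin ∪ S_prod)`.

THE CUT is unchanged since the birth skeleton (lattice factorisation through the Γ-sector of the
sibling routes TerasomaMultiplication / MotivedMoves, in Cresson–Viu-Sos volume form):

  crux ⟸ (Γ-complement) ∧ (Γ-sector collapses onto the β-sector modulo moves).

WHAT v5 CHANGES (and why). Leads c8–c10 registered v4, whose two open stubs
`stub_volumeCompleteModGammaBeta` / `stub_longPairsModBeta` are the EXACT residual (kernel-checked:
`FermatSectorCompleteBridges.fermatSectorComplete_iff_volumeBeta_and_longPairs`, crux ⟺ stub 1 ∧ stub 2l)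
but are, as statements, private costumes of two EXISTING crux items of route TerasomaMultiplication:
stub 1 ⟸ `CompleteModGammaSector` (stmt-14233, `volumeCompleteModGammaBeta_of_completeModGammaSector`),
stub 2l ⟸ `GammaHodgeSector` (stmt-3742, `longPairsModBeta_of_gammaHodgeSector`). Three consecutive
lead seats ended `blocked-on: stmt-14233` and were re-seated within minutes. v5 therefore states the
two stubs AS THOSE ITEMS, BY NAME, so that the dependency of this crux on stmt-14233 and stmt-3742 is
machine-readable from the registered skeleton (docs/architecture/prover-allocation.md §4.3: a crux whose
statement appears as a stub in another crux's skeleton is worked first) and no seat re-derives it: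

  (stub 1) `stub_completeModGammaSector : …Theses.TerasomaMultiplication.CompleteModGammaSector`
           — item stmt-14233 verbatim (Conjecture 1 modulo the Deligne–Koblitz–Ogus Γ-Hodge pairs;
           open problem, GPC strength; its own line leads / strategist census live under
           `Cruxes/CompleteModGammaSector/`).
  (stub 2) `stub_gammaHodgeSector : …Theses.TerasomaMultiplication.GammaHodgeSector`
           — item stmt-3742 verbatim (every Γ-Hodge pair difference is a KZ relation; its lead is
           blocked-on stmt-5621 `PositiveCancellation`; alternative road stmt-13633 `BetaCancellation`
           ∧ stmt-14858 `GapSectorBeyondTwelve`, compiled by the landed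
           `GammaHodgeSectorKO.gammaHodgeSector_of_either_road`).

COMPOSITION (`FermatSectorComplete_of : FermatSectorComplete`, stubs used BY NAME): the landed bridge
`FermatSectorCompleteBridges.fermatSectorComplete_of_completeModGammaSector_of_gammaHodgeSector`
(p144355; it is v4's composition with stub 2s = `stub_shortPairsModBeta` LANDED, p141915, and the
relative Cresson–Viu-Sos lift `InverseLandau.VolumeFormLift.of_sub_of_mem` inside).

PRECISION NOTE (nothing is lost). v5's stubs are a priori STRONGER than the crux needs (the crux does not
obviously give back 14233 or 3742: `closure S_prod` and `closure (Γ-pairs)` are syntactically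
incomparable — S_prod allows integer exponents and carries no Hodge condition). The exact, crux-implied
residual remains available as the tree theorem `fermatSectorComplete_iff_volumeBeta_and_longPairs`, and
the finer roads as `fermatSectorComplete_of_items : CompleteModGammaSector → (PositiveCancellation ∨
(BetaCancellation ∧ GapSectorBeyondTwelve)) → FermatSectorComplete`. When stmt-3742 (or 5621, or
13633 ∧ 14858) closes, stub 2 closes in one line; when stmt-14233 closes, stub 1 closes in one line.

Disproof used: none exists on this item (`ledger crux ls`, 2026-08-17T07:38Z: no Disproof.lean, no
`Theorems/FermatSectorComplete/Negative/`); refuter Evidence.lean (relS_le_ker, iff_kernel,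
iff_algebraic, not_withoutValueEq) respected — value equality stays load-bearing inside both items.

References: Kontsevich–Zagier 2001 §1.2 (Conjecture 1); Cresson–Viu-Sos, JTNB 34 (2022) §1;
Deligne 1982 (Hodge cycles) Thm 7.18 with the Koblitz–Ogus appendix; Huber–Wüstholz 2022 Thm 13.3.
-/

-- `Summit.KontsevichZagierPeriods.KontsevichZagierPeriods.…` is the tree's mandated layout (single-conjunct summit).
set_option linter.dupNamespace false

namespace Summit.KontsevichZagierPeriods.KontsevichZagierPeriods.Cruxes.FermatSectorComplete.Birth

/-- **Stub 1 (v5) — the Γ-complement, stated AS the existing item stmt-14233 by name**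
(`TerasomaMultiplication.CompleteModGammaSector`): for every subgroup `H ⊇ relations` containing the
difference of every Deligne–Koblitz–Ogus Γ-Hodge pair, any two `IsRational` representations of equal
value differ by an element of `H` — Conjecture 1 modulo the Γ-sector.
Position: implies v4's `stub_volumeCompleteModGammaBeta`
(`FermatSectorCompleteBridges.volumeCompleteModGammaBeta_of_completeModGammaSector`); equivalent to v2's
`stub_volumeCompleteModGamma` (`…Bridges.volumeCompleteModGamma_iff_completeModGammaSector`).
Size: open problem (GPC strength off the CM sector: the dimension-2 rational pairs Catalan,
log 2·log 3/π², ζ(3)/π³ are its first instances; barrier `kzConjecture_implies_oddZetaAlgIndep` binds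
it in full; four lead seats and a strategist census on stmt-14233 concur). Leans on: nothing unproved
besides being item stmt-14233 itself. -/
theorem stub_completeModGammaSector :
    Summit.KontsevichZagierPeriods.KontsevichZagierPeriods.Theses.TerasomaMultiplication.CompleteModGammaSector := by
  sorry

/-- **Stub 2 (v5) — the Γ-sector collapses into the relations, stated AS the existing item stmt-3742
by name** (`TerasomaMultiplication.GammaHodgeSector`): every Deligne–Koblitz–Ogus Γ-Hodge pair
difference `[ρ] − [ρ']` (positive non-integer rational exponents, Hodge-type condition via `Int.fract`,
`c` real algebraic, pinned cube / 2k-ball × cube representations, equal values) is a KZ relation.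
Position: implies v4's `stub_longPairsModBeta` (`…Bridges.longPairsModBeta_of_gammaHodgeSector`);
the short words (`N ≤ 2 ∧ k + N' ≤ 2`) are already in the β-sector unconditionally
(`FermatSectorCompleteShortPairs.stub_shortPairsModBeta`, p141915). Roads (landed compiler
`GammaHodgeSectorKO.gammaHodgeSector_of_either_road`): stmt-5621 `PositiveCancellation`, or
stmt-13633 `BetaCancellation` ∧ stmt-14858 `GapSectorBeyondTwelve`. Size: XL / open
(Rohrlich–Lang-fragment strength beyond the Das gap level). Leans on: being item stmt-3742 itself. -/
theorem stub_gammaHodgeSector :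
    Summit.KontsevichZagierPeriods.KontsevichZagierPeriods.Theses.TerasomaMultiplication.GammaHodgeSector := by
  sorry

/-- **Composition** — the crux BY NAME from the two stubs, through the landed bridge
`fermatSectorComplete_of_completeModGammaSector_of_gammaHodgeSector` (p144355): stub 2 puts every
Γ-Hodge pair into `relations ≤ relations ⊔ closure (S_lin ∪ S_prod)` (long words; short words by the
landed `stub_shortPairsModBeta`), which discharges the Γ-hypothesis of stub 1 at
`H := relations ⊔ closure (S_lin ∪ S_prod)`; the `IsRational` hypotheses of the crux are passed through.
No sorry here: the only sorries of the file are the two `stub_*`, each an existing open item.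
[cite: KontsevichZagier2001, §1.2 Conjecture 1] -/
theorem FermatSectorComplete_of :
    Summit.KontsevichZagierPeriods.KontsevichZagierPeriods.Theses.FermatIsogeny.FermatSectorComplete :=
  Summit.KontsevichZagierPeriods.FermatIsogeny.FermatSectorCompleteBridges.fermatSectorComplete_of_completeModGammaSector_of_gammaHodgeSector
    stub_completeModGammaSector stub_gammaHodgeSector

end Summit.KontsevichZagierPeriods.KontsevichZagierPeriods.Cruxes.FermatSectorComplete.Birth
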